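import Summits.BirchSwinnertonDyer.BirchSwinnertonDyer.Theorems.ByReductionTypeAtTwoAdditivePotGoodLowerHalfT0ClassLiftF
import Summits.BirchSwinnertonDyer.BirchSwinnertonDyer.Theorems.ByReductionTypeAtTwoAdditivePotGoodLowerHalfT0ClassLiftG
import Summits.BirchSwinnertonDyer.BirchSwinnertonDyer.Theorems.ByReductionTypeAtTwoAdditivePotGoodLowerHalfT0NarrowRankStampsA
import Summits.BirchSwinnertonDyer.BirchSwinnertonDyer.Theorems.ByReductionTypeAtTwoAdditivePotGoodLowerHalfT0NarrowRankStampsB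
import Summits.BirchSwinnertonDyer.BirchSwinnertonDyer.Theorems.ByReductionTypeAtTwoOrdKatoHalfAtTwoIsoConjATwoOfNarrowRankLayerTwo
import HarnessLib

/-!
# K4 crux `AdditiveRankZeroAtTwo` (19098), child C3″ `AdditivePotGoodLowerHalfAtTwo` (item 22617): the RUNG `n = 1` of the NARROW RANK CERTIFICATE for the
# `Δ_cubic > 0` rows `261648q1`, `279440c1`, `293200be1` — (A)₂ and the BSD₂ rungs from ONE displayed equality `rank₂ Cl⁺(ℚ(θ)·ℚ₂) = rank₂ Cl⁺(ℚ(θ)·ℚ₁)` (layers `1 / 2` of the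
# cubic point field's cyclotomic `ℤ₂`-tower, degrees `12` and `6`), NO index and NO bound displayed (file A of the series `NarrowRankLayerTwoRows` A–C;
# seat `bsd-2adic-k4-w2` GEN 12; `--supports stmt-BirchSwinnertonDyer-22617 --as helper`)

Cell `bsd-2adic`. cruxlead-19573-w2 GEN 10 landed the rung `n = 1` of NARROW FUKUDA (p744372 `…OrdKatoHalfAtTwoIsoConjATwoOfNarrowRankLayerTwo`: a cubic field has
Fukuda index `≤ 1` along every cyclotomic `ℤ₂`-extension — `forall_totallyRamifiedFrom_one_of_finrank_eq_three` — and the layer-`0/1` narrow `2`-ranks are bounded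
uniformly in `κ`, `NarrowRankCert.exists_narrowRankCertificate_one_of_finrank_eq_three`), so GEN 11's general stamps `AddKatoTwo.conjA_two_<L>_of_narrowRankCert hθ n B`
(kernel `n₀ = 0` on the cubic, `…LowerHalfT0NarrowRankStamps{A,B,C,D}`) specialise at `n = 1` to ONE displayed datum. This file supplies, per row: §1 the CENSUS
INSTANCE `AddKatoTwo.conjA_two_<L>_of_narrowRankEq₁₂ hθ hnr` — (A)₂ with NO print fact from ONE equality of narrow `2`-ranks at the layers `1 / 2` (abstract layers, any
`NumberField` instances; the concrete fields are `ℚ(θ, √2)` and `ℚ(θ, √(2+√2))`); §2 GEN 3's rungs re-keyed: `AddPotGoodInstances.bsdp_two_<L>_narrowRankEq₁₂`,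
`bsdp_two_of_isIsogenous_<L>_narrowRankEq₁₂` — BSD₂ on the class ⟸ PRINT {hSharp (reading), hGZK, hmod, hCT(, hCassels)} + RECORD {r_an = 0, #Ш_an = q, ord₂ q
bounded} + the two VALUED Selmer slots + `hnr`.

WHY THE RUNG `n = 1`. Seat-local exact arithmetic of this GEN (pure integer arithmetic, reproducible: explicit units of `ℚ(θ)` taking all `8` sign patterns, so
`h⁺(ℚ(θ)) = h(ℚ(θ)) = 1`, and — by the square class of `d_K` in `ℚ₂ˣ` — at least TWO primes of `ℚ(θ)` ramified in `ℚ(θ, √2)`) shows by NARROW GENUS THEORY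
(`#` narrow ambiguous classes `= h⁺ · 2^(t−1) / [E⁺ : E⁺ ∩ N] = 2`) that `rank₂ Cl⁺(ℚ(θ,√2)) ≥ 1 > 0 = rank₂ Cl⁺(ℚ(θ))` on the rows `261648q1`, `279440c1`,
`293200be1`, `412992bw1`: there the layer-`0/1` equality displayed by GEN 11's `conjA_two_<L>_of_narrowRankEq₀₁` is FALSE (that stamp is vacuous) and the rung `n = 1`
is the first one that can hold (evidence memo `CENSUS-22617-k4w2-GEN12.md` on the item; census letters, never a Lean fact). For `445508b1` (`#(U⁺/U²)(ℚ(θ)) = 2`,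
k4-w1 GEN 10) and `467928d1`, `174920h1` the layer-`0/1` letter is open and this rung is the fallback.

HONEST FRAMING (D-0036 / D-0054 / D-0152): conditional theorems; `hnr` is an INSTRUMENT-tier datum, UNVALUED when this file lands (PARI `bnfnarrow` at degrees `6` and
`12`; kit `narrow-6` GRANTED to eng-2, RC-502); if the narrow `2`-rank grows again between the layers `1` and `2` this rung fails too (next pair `(2, 3)`, degree `24`,
GEN 11's general stamp with `n = 2`), which refutes nothing. `hSharp` is the Kato-at-`2` SHARP reading (D-audit PASS). Closes nothing at the `∀`-level (C3″ 22617 /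
C1″ 22615 OPEN); nothing booked (D-0054); no rung moves; BSD is not proved by any of this. THEOREMS ONLY (no `def`).

References: [Fukuda1994] Thm. 1 (2), p. 264; [Washington1997] §13.1 Prop. 13.2, Lemma 13.3; [Kida1982JFields] main theorem (shape); [CoatesSujatha2005] (A), Thm. 3.4;
[Kato2004Asterisque] Thm. 12.5 (1)(3), 13.8, 14.14; [Cassels1965ArithmeticVIII] Thm. 1.3; [Miller2011LMS] Def. 1.1; [Gras2003CFT] IV.4 (narrow genus theory).
-/

set_option autoImplicit false
-- the Theorems namespace of this sub repeats the summit name by design (D-0017 nested layout)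
set_option linter.dupNamespace false

noncomputable section

open scoped Classical IntermediateField NumberField Real nonZeroDivisors

/-! ## §1 The rung `n = 1` census instances (namespace `AddKatoTwo`) -/

namespace Summit.BirchSwinnertonDyer.BirchSwinnertonDyer.Theorems.AddKatoTwo

open WeierstrassCurve Field Polynomial IsDedekindDomain NumberField Matrix Literature.NumberTheory.EllipticCurves
  Literature.NumberTheory.GaloisRepresentations
  Literature.NumberTheory.IwasawaTheory
  Literature.NumberTheory.NumberFields
  Summit.BirchSwinnertonDyer.BirchSwinnertonDyer.Theorems.SteinbergFibreAtTwo
  Summit.BirchSwinnertonDyer.BirchSwinnertonDyer.Theorems.AlignedTransportAtTwoTorsionPointField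
  Summit.BirchSwinnertonDyer.BirchSwinnertonDyer.Theses.ByReductionTypeAtTwo

/-- **(A)₂ for `261648q1` from the RUNG `n = 1` of the narrow rank certificate — the CENSUS INSTANCE at layers `1 / 2`: ONE displayed equality
`rank₂ Cl⁺(ℚ(θ)·ℚ₂) = rank₂ Cl⁺(ℚ(θ)·ℚ₁)`** (`ℚ(θ)·ℚ₁ = ℚ(θ, √2)`, `ℚ(θ)·ℚ₂ = ℚ(θ, √(2+√2))`, degrees `6` and `12`; abstract layers of every cyclotomic `ℤ₂`-extension
of `ℚ(θ)`, any `NumberField` instances) — instrument tier, UNVALUED at landing time (kit `narrow-6` GRANTED, RC-502). Row data: `d = 316`, `2 = 𝔭𝔮²`, `h = 1`; seat-local exact arithmetic (GEN 12): `h⁺(ℚ(θ)) = 1` and ≥ 2 primes of `ℚ(θ)` ramify in `ℚ(θ,√2)`, so the layer-`0/1` equality FAILS by narrow genus theory — this rung `n = 1` is the row's live road.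
NO index `n₀` and NO bound `B` are displayed: a cubic field has Fukuda index `≤ 1` along every cyclotomic `ℤ₂`-extension and the layer-`0/1` narrow ranks are
bounded uniformly in `κ` (cruxlead-19573-w2 GEN 10 `NarrowRankCert.exists_narrowRankCertificate_one_of_finrank_eq_three`, p744372); GEN 11's general stamp
`conjA_two_261648q1_of_narrowRankCert hθ 1 B` (kernel `n₀ = 0`) then gives (A)₂. `θ` is any root of `X³ + (-1)X² + (-4)X + (2)`. BSD for `261648q1` is NOT proved by this.
[cite: Fukuda1994, Thm. 1 (2), p. 264] [cite: Washington1997, §13.1 and Lemma 13.3] [cite: CoatesSujatha2005, Conj. A and Thm. 3.4] -/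
theorem conjA_two_261648q1_of_narrowRankEq₁₂
    {θ : AlgebraicClosure ℚ} (hθ : aeval θ (Cubic.toPoly ⟨1, ((-1 : ℤ) : ℚ), ((-4 : ℤ) : ℚ), ((2 : ℤ) : ℚ)⟩) = 0)
    (hnr : haveI : FiniteDimensional ℚ (IntermediateField.adjoin ℚ {θ}) :=
        IntermediateField.adjoin.finiteDimensional ((AlgebraicClosure.isAlgebraic ℚ).isAlgebraic θ).isIntegral
      haveI : NumberField (IntermediateField.adjoin ℚ {θ}) := NumberField.mk
      ∀ κL : ZpExtension (IntermediateField.adjoin ℚ {θ}) 2, κL.IsCyclotomic →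
        ∀ [NumberField ↥(κL.layer 1)] [NumberField ↥(κL.layer 2)],
          (powMonoidHom (α := NarrowClassGroup ↥(κL.layer 2)) 2).range.index =
            (powMonoidHom (α := NarrowClassGroup ↥(κL.layer 1)) 2).range.index)
    (κ : ZpExtension ℚ 2) (hκ : κ.IsCyclotomic) :
    haveI := (isElliptic_cubicModel _ _ _ (by simp only [Cubic.discr]; norm_num) : (⟨0, ((0 : ℤ) : ℚ), 0, ((-3540805887 : ℤ) : ℚ), ((-81096346959158 : ℤ) : ℚ)⟩ : WeierstrassCurve ℚ).IsElliptic)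
    ∃ (γ : absoluteGaloisGroup ℚ) (D : (⟨0, ((0 : ℤ) : ℚ), 0, ((-3540805887 : ℤ) : ℚ), ((-81096346959158 : ℤ) : ℚ)⟩ : WeierstrassCurve ℚ).FineSelmerDualData κ γ),
      Module.Finite ℤ_[2] (RestrictScalars ℤ_[2] (IwasawaAlgebra 2) D.X) := by
  haveI : FiniteDimensional ℚ (IntermediateField.adjoin ℚ {θ}) :=
    IntermediateField.adjoin.finiteDimensional ((AlgebraicClosure.isAlgebraic ℚ).isAlgebraic θ).isIntegral
  haveI : NumberField (IntermediateField.adjoin ℚ {θ}) := NumberField.mk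
  have h3 := finrank_adjoin_eq_three_of_irreducible irreducible_cubic_d316p hθ
  obtain ⟨B, hB⟩ := NarrowRankCert.exists_narrowRankCertificate_one_of_finrank_eq_three h3 hnr
  exact conjA_two_261648q1_of_narrowRankCert hθ 1 B (fun κL hκL => (hB κL hκL).2) κ hκ

/-- **(A)₂ for `279440c1` from the RUNG `n = 1` of the narrow rank certificate — the CENSUS INSTANCE at layers `1 / 2`: ONE displayed equality
`rank₂ Cl⁺(ℚ(θ)·ℚ₂) = rank₂ Cl⁺(ℚ(θ)·ℚ₁)`** (`ℚ(θ)·ℚ₁ = ℚ(θ, √2)`, `ℚ(θ)·ℚ₂ = ℚ(θ, √(2+√2))`, degrees `6` and `12`; abstract layers of every cyclotomic `ℤ₂`-extension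
of `ℚ(θ)`, any `NumberField` instances) — instrument tier, UNVALUED at landing time (kit `narrow-6` GRANTED, RC-502). Row data: `d = 9980`, `2 = 𝔭²𝔮`, `h = 1`; seat-local exact arithmetic (GEN 12): `h⁺(ℚ(θ)) = 1`, two primes ramify in `ℚ(θ,√2)` ⟹ the layer-`0/1` equality FAILS (narrow genus theory) — this rung is the row's live road.
NO index `n₀` and NO bound `B` are displayed: a cubic field has Fukuda index `≤ 1` along every cyclotomic `ℤ₂`-extension and the layer-`0/1` narrow ranks are
bounded uniformly in `κ` (cruxlead-19573-w2 GEN 10 `NarrowRankCert.exists_narrowRankCertificate_one_of_finrank_eq_three`, p744372); GEN 11's general stamp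
`conjA_two_279440c1_of_narrowRankCert hθ 1 B` (kernel `n₀ = 0`) then gives (A)₂. `θ` is any root of `X³ + (-1)X² + (-36)X + (-70)`. BSD for `279440c1` is NOT proved by this.
[cite: Fukuda1994, Thm. 1 (2), p. 264] [cite: Washington1997, §13.1 and Lemma 13.3] [cite: CoatesSujatha2005, Conj. A and Thm. 3.4] -/
theorem conjA_two_279440c1_of_narrowRankEq₁₂
    {θ : AlgebraicClosure ℚ} (hθ : aeval θ (Cubic.toPoly ⟨1, ((-1 : ℤ) : ℚ), ((-36 : ℤ) : ℚ), ((-70 : ℤ) : ℚ)⟩) = 0)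
    (hnr : haveI : FiniteDimensional ℚ (IntermediateField.adjoin ℚ {θ}) :=
        IntermediateField.adjoin.finiteDimensional ((AlgebraicClosure.isAlgebraic ℚ).isAlgebraic θ).isIntegral
      haveI : NumberField (IntermediateField.adjoin ℚ {θ}) := NumberField.mk
      ∀ κL : ZpExtension (IntermediateField.adjoin ℚ {θ}) 2, κL.IsCyclotomic →
        ∀ [NumberField ↥(κL.layer 1)] [NumberField ↥(κL.layer 2)],
          (powMonoidHom (α := NarrowClassGroup ↥(κL.layer 2)) 2).range.index =
            (powMonoidHom (α := NarrowClassGroup ↥(κL.layer 1)) 2).range.index)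
    (κ : ZpExtension ℚ 2) (hκ : κ.IsCyclotomic) :
    haveI := (isElliptic_cubicModel _ _ _ (by simp only [Cubic.discr]; norm_num) : (⟨0, ((1 : ℤ) : ℚ), 0, ((-114041197436 : ℤ) : ℚ), ((-14823196533966296 : ℤ) : ℚ)⟩ : WeierstrassCurve ℚ).IsElliptic)
    ∃ (γ : absoluteGaloisGroup ℚ) (D : (⟨0, ((1 : ℤ) : ℚ), 0, ((-114041197436 : ℤ) : ℚ), ((-14823196533966296 : ℤ) : ℚ)⟩ : WeierstrassCurve ℚ).FineSelmerDualData κ γ),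
      Module.Finite ℤ_[2] (RestrictScalars ℤ_[2] (IwasawaAlgebra 2) D.X) := by
  haveI : FiniteDimensional ℚ (IntermediateField.adjoin ℚ {θ}) :=
    IntermediateField.adjoin.finiteDimensional ((AlgebraicClosure.isAlgebraic ℚ).isAlgebraic θ).isIntegral
  haveI : NumberField (IntermediateField.adjoin ℚ {θ}) := NumberField.mk
  have h3 := finrank_adjoin_eq_three_of_irreducible irreducible_cubic_d9980p hθ
  obtain ⟨B, hB⟩ := NarrowRankCert.exists_narrowRankCertificate_one_of_finrank_eq_three h3 hnr
  exact conjA_two_279440c1_of_narrowRankCert hθ 1 B (fun κL hκL => (hB κL hκL).2) κ hκ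

/-- **(A)₂ for `293200be1` from the RUNG `n = 1` of the narrow rank certificate — the CENSUS INSTANCE at layers `1 / 2`: ONE displayed equality
`rank₂ Cl⁺(ℚ(θ)·ℚ₂) = rank₂ Cl⁺(ℚ(θ)·ℚ₁)`** (`ℚ(θ)·ℚ₁ = ℚ(θ, √2)`, `ℚ(θ)·ℚ₂ = ℚ(θ, √(2+√2))`, degrees `6` and `12`; abstract layers of every cyclotomic `ℤ₂`-extension
of `ℚ(θ)`, any `NumberField` instances) — instrument tier, UNVALUED at landing time (kit `narrow-6` GRANTED, RC-502). Row data: `d = 733` (odd; `2 = 𝔭𝔮`, `f = 1, 2`), `h = 1`; seat-local exact arithmetic (GEN 12): `h⁺ = 1`, both primes ramify in `ℚ(θ,√2)` ⟹ the layer-`0/1` equality FAILS — this rung is the row's live road.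
NO index `n₀` and NO bound `B` are displayed: a cubic field has Fukuda index `≤ 1` along every cyclotomic `ℤ₂`-extension and the layer-`0/1` narrow ranks are
bounded uniformly in `κ` (cruxlead-19573-w2 GEN 10 `NarrowRankCert.exists_narrowRankCertificate_one_of_finrank_eq_three`, p744372); GEN 11's general stamp
`conjA_two_293200be1_of_narrowRankCert hθ 1 B` (kernel `n₀ = 0`) then gives (A)₂. `θ` is any root of `X³ + (-1)X² + (-7)X + (8)`. BSD for `293200be1` is NOT proved by this.
[cite: Fukuda1994, Thm. 1 (2), p. 264] [cite: Washington1997, §13.1 and Lemma 13.3] [cite: CoatesSujatha2005, Conj. A and Thm. 3.4] -/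
theorem conjA_two_293200be1_of_narrowRankEq₁₂
    {θ : AlgebraicClosure ℚ} (hθ : aeval θ (Cubic.toPoly ⟨1, ((-1 : ℤ) : ℚ), ((-7 : ℤ) : ℚ), ((8 : ℤ) : ℚ)⟩) = 0)
    (hnr : haveI : FiniteDimensional ℚ (IntermediateField.adjoin ℚ {θ}) :=
        IntermediateField.adjoin.finiteDimensional ((AlgebraicClosure.isAlgebraic ℚ).isAlgebraic θ).isIntegral
      haveI : NumberField (IntermediateField.adjoin ℚ {θ}) := NumberField.mk
      ∀ κL : ZpExtension (IntermediateField.adjoin ℚ {θ}) 2, κL.IsCyclotomic →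
        ∀ [NumberField ↥(κL.layer 1)] [NumberField ↥(κL.layer 2)],
          (powMonoidHom (α := NarrowClassGroup ↥(κL.layer 2)) 2).range.index =
            (powMonoidHom (α := NarrowClassGroup ↥(κL.layer 1)) 2).range.index)
    (κ : ZpExtension ℚ 2) (hκ : κ.IsCyclotomic) :
    haveI := (isElliptic_cubicModel _ _ _ (by simp only [Cubic.discr]; norm_num) : (⟨0, ((1 : ℤ) : ℚ), 0, ((-3388217033 : ℤ) : ℚ), ((-75912170159062 : ℤ) : ℚ)⟩ : WeierstrassCurve ℚ).IsElliptic)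
    ∃ (γ : absoluteGaloisGroup ℚ) (D : (⟨0, ((1 : ℤ) : ℚ), 0, ((-3388217033 : ℤ) : ℚ), ((-75912170159062 : ℤ) : ℚ)⟩ : WeierstrassCurve ℚ).FineSelmerDualData κ γ),
      Module.Finite ℤ_[2] (RestrictScalars ℤ_[2] (IwasawaAlgebra 2) D.X) := by
  haveI : FiniteDimensional ℚ (IntermediateField.adjoin ℚ {θ}) :=
    IntermediateField.adjoin.finiteDimensional ((AlgebraicClosure.isAlgebraic ℚ).isAlgebraic θ).isIntegral
  haveI : NumberField (IntermediateField.adjoin ℚ {θ}) := NumberField.mk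
  have h3 := finrank_adjoin_eq_three_of_irreducible irreducible_cubic_disc_733 hθ
  obtain ⟨B, hB⟩ := NarrowRankCert.exists_narrowRankCertificate_one_of_finrank_eq_three h3 hnr
  exact conjA_two_293200be1_of_narrowRankCert hθ 1 B (fun κL hκL => (hB κL hκL).2) κ hκ

end Summit.BirchSwinnertonDyer.BirchSwinnertonDyer.Theorems.AddKatoTwo

/-! ## §2 The C3″ rungs (namespace `AddPotGoodInstances`) -/

namespace Summit.BirchSwinnertonDyer.BirchSwinnertonDyer.Theorems.AddPotGoodInstances

open WeierstrassCurve Polynomial Literature.NumberTheory.EllipticCurves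
  Literature.NumberTheory.IwasawaTheory
  Literature.NumberTheory.NumberFields
  Literature.NumberTheory.EllipticCurves.Rank1Residual
  Literature.NumberTheory.EllipticCurves.Rank1Residual.Typed
  Summit.BirchSwinnertonDyer.Rank1Residual
  Summit.BirchSwinnertonDyer.Rank1Residual.Additive
  Summit.BirchSwinnertonDyer.BirchSwinnertonDyer.Theorems

/-- Model transport for (A) at `2` in the `∃ γ D` spelling (the statement only depends on the Weierstrass CURVE).
[cite: CoatesSujatha2005, statement (A)] -/
private theorem conjA_two_of_eq'' {W W' : WeierstrassCurve ℚ} (h : W' = W)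
    (H : ∀ (κ : ZpExtension ℚ 2), κ.IsCyclotomic →
      ∃ (γ : Field.absoluteGaloisGroup ℚ) (D : W'.FineSelmerDualData κ γ), Module.Finite ℤ_[2] (RestrictScalars ℤ_[2] (IwasawaAlgebra 2) D.X)) :
    ∀ (κ : ZpExtension ℚ 2), κ.IsCyclotomic →
      ∃ (γ : Field.absoluteGaloisGroup ℚ) (D : W.FineSelmerDualData κ γ), Module.Finite ℤ_[2] (RestrictScalars ℤ_[2] (IwasawaAlgebra 2) D.X) := by
  subst h; exact H

/-! ## Row `261648q1` (Δ_cubic > 0; stamp `AddKatoTwo.conjA_two_261648q1_of_narrowRankEq₁₂` of §1) -/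

/-- **(A) at `(261648q1, 2)` for the Cremona model from ONE displayed narrow-rank equality at layers `1 / 2`, NO print fact**: §1's stamp transported
from its cast model to the literal model. [cite: CoatesSujatha2005, statement (A)] -/
theorem conjA_two_261648q1_of_narrowRankEq₁₂_kernelLit
    {θ : AlgebraicClosure ℚ} (hθ : aeval θ (Cubic.toPoly ⟨1, ((-1 : ℤ) : ℚ), ((-4 : ℤ) : ℚ), ((2 : ℤ) : ℚ)⟩) = 0)
    (hnr : haveI : FiniteDimensional ℚ (IntermediateField.adjoin ℚ {θ}) :=
        IntermediateField.adjoin.finiteDimensional ((AlgebraicClosure.isAlgebraic ℚ).isAlgebraic θ).isIntegral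
      haveI : NumberField (IntermediateField.adjoin ℚ {θ}) := NumberField.mk
      ∀ κL : ZpExtension (IntermediateField.adjoin ℚ {θ}) 2, κL.IsCyclotomic →
        ∀ [NumberField ↥(κL.layer 1)] [NumberField ↥(κL.layer 2)],
          (powMonoidHom (α := NarrowClassGroup ↥(κL.layer 2)) 2).range.index =
            (powMonoidHom (α := NarrowClassGroup ↥(κL.layer 1)) 2).range.index)
    :
    haveI := isElliptic_261648q1
    ∀ (κ : ZpExtension ℚ 2), κ.IsCyclotomic →
      ∃ (γ : Field.absoluteGaloisGroup ℚ) (D : (⟨0, 0, 0, -3540805887, -81096346959158⟩ : WeierstrassCurve ℚ).FineSelmerDualData κ γ),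
        Module.Finite ℤ_[2] (RestrictScalars ℤ_[2] (IwasawaAlgebra 2) D.X) :=
  conjA_two_of_eq'' (W' := (⟨0, ((0 : ℤ) : ℚ), 0, ((-3540805887 : ℤ) : ℚ), ((-81096346959158 : ℤ) : ℚ)⟩ : WeierstrassCurve ℚ)) (by norm_num) (fun κ hκ ↦ AddKatoTwo.conjA_two_261648q1_of_narrowRankEq₁₂ hθ hnr κ hκ)

/-- **`BSD₂(261648q1)` with (A) from ONE displayed narrow-rank equality at layers `1 / 2` and NO print fact for (A)**: GEN 3's rung `bsdp_two_261648q1_of_conjA` with `hA`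
from `conjA_two_261648q1_of_narrowRankEq₁₂_kernelLit hθ hnr`. Conditional on PRINT {`hSharp` (reading), `hGZK`, `hmod`, `hCT`}, the RECORD `hr`, `#Ш_an = q`
(bounded `ord₂ q`), the two VALUED slots and the (unvalued) instrument equality `hnr` — the rung `n = 1` companion of GEN 11's `…narrowRankEq` rung (layers `0 / 1`).
Nothing booked; BSD is not proved by this. [cite: Kato2004Asterisque, Thm. 12.5 (1)(3), 13.8, 14.14] [cite: Fukuda1994, Thm. 1 (2)] [cite: Miller2011LMS, Def. 1.1] -/
theorem bsdp_two_261648q1_narrowRankEq₁₂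
    (hSharp : Kato2004.rankZero_padicValNat_sha_add_padicValNat_tamagawa_le_at_two_of_irreducible_of_fineSelmerDual_fg)
    (hGZK : rank_eq_analyticRank_of_analyticRank_le_one) (hmod : hasEntireLFunction_rat)
    (hCT : exists_casselsTate_pairing (K := ℚ))
    {θ : AlgebraicClosure ℚ} (hθ : aeval θ (Cubic.toPoly ⟨1, ((-1 : ℤ) : ℚ), ((-4 : ℤ) : ℚ), ((2 : ℤ) : ℚ)⟩) = 0)
    (hnr : haveI : FiniteDimensional ℚ (IntermediateField.adjoin ℚ {θ}) :=
        IntermediateField.adjoin.finiteDimensional ((AlgebraicClosure.isAlgebraic ℚ).isAlgebraic θ).isIntegral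
      haveI : NumberField (IntermediateField.adjoin ℚ {θ}) := NumberField.mk
      ∀ κL : ZpExtension (IntermediateField.adjoin ℚ {θ}) 2, κL.IsCyclotomic →
        ∀ [NumberField ↥(κL.layer 1)] [NumberField ↥(κL.layer 2)],
          (powMonoidHom (α := NarrowClassGroup ↥(κL.layer 2)) 2).range.index =
            (powMonoidHom (α := NarrowClassGroup ↥(κL.layer 1)) 2).range.index)
    (hr : haveI := isElliptic_261648q1; (⟨0, 0, 0, -3540805887, -81096346959158⟩ : WeierstrassCurve ℚ).analyticRank = 0)
    (hs₁ : Nat.card ((⟨0, 0, 0, -3540805887, -81096346959158⟩ : WeierstrassCurve ℚ).selmerGroup (2 ^ 2)) = 2 ^ 4)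
    (hs₂ : Nat.card ((⟨0, 0, 0, -3540805887, -81096346959158⟩ : WeierstrassCurve ℚ).selmerGroup (2 ^ (2 + 1))) = 2 ^ 6)
    {q : ℚ} (hq : haveI := isElliptic_261648q1; shaAn (⟨0, 0, 0, -3540805887, -81096346959158⟩ : WeierstrassCurve ℚ) = (q : ℂ)) (hv : padicValRat 2 q ≤ 6) :
    haveI := isElliptic_261648q1; haveI := isGloballyMinimal_261648q1
    BSDp (⟨0, 0, 0, -3540805887, -81096346959158⟩ : WeierstrassCurve ℚ) 2 := by
  exact bsdp_two_261648q1_of_conjA hSharp hGZK hmod hCT (conjA_two_261648q1_of_narrowRankEq₁₂_kernelLit hθ hnr) hr hs₁ hs₂ hq hv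

/-- **`BSD₂` ON THE WHOLE CLASS of `261648q1` with (A) from ONE displayed narrow-rank equality at layers `1 / 2` and NO print fact for (A)**: GEN 3's class rung
(Cassels transport `hCassels`) with `hA` from `conjA_two_261648q1_of_narrowRankEq₁₂_kernelLit hθ hnr`. Nothing booked; BSD is not proved by this.
[cite: Cassels1965ArithmeticVIII, Thm. 1.3] [cite: Kato2004Asterisque, Thm. 12.5 (1)(3)] [cite: Fukuda1994, Thm. 1 (2)] -/
theorem bsdp_two_of_isIsogenous_261648q1_narrowRankEq₁₂
    (hSharp : Kato2004.rankZero_padicValNat_sha_add_padicValNat_tamagawa_le_at_two_of_irreducible_of_fineSelmerDual_fg)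
    (hGZK : rank_eq_analyticRank_of_analyticRank_le_one) (hmod : hasEntireLFunction_rat)
    (hCT : exists_casselsTate_pairing (K := ℚ)) (hCassels : bsdRHS_eq_of_isIsogenous)
    {θ : AlgebraicClosure ℚ} (hθ : aeval θ (Cubic.toPoly ⟨1, ((-1 : ℤ) : ℚ), ((-4 : ℤ) : ℚ), ((2 : ℤ) : ℚ)⟩) = 0)
    (hnr : haveI : FiniteDimensional ℚ (IntermediateField.adjoin ℚ {θ}) :=
        IntermediateField.adjoin.finiteDimensional ((AlgebraicClosure.isAlgebraic ℚ).isAlgebraic θ).isIntegral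
      haveI : NumberField (IntermediateField.adjoin ℚ {θ}) := NumberField.mk
      ∀ κL : ZpExtension (IntermediateField.adjoin ℚ {θ}) 2, κL.IsCyclotomic →
        ∀ [NumberField ↥(κL.layer 1)] [NumberField ↥(κL.layer 2)],
          (powMonoidHom (α := NarrowClassGroup ↥(κL.layer 2)) 2).range.index =
            (powMonoidHom (α := NarrowClassGroup ↥(κL.layer 1)) 2).range.index)
    {W : WeierstrassCurve ℚ} [W.IsElliptic] [W.IsGloballyMinimal]
    (hiso : haveI := isElliptic_261648q1; IsIsogenous W (⟨0, 0, 0, -3540805887, -81096346959158⟩ : WeierstrassCurve ℚ)) (hr : W.analyticRank = 0)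
    (hs₁ : Nat.card ((⟨0, 0, 0, -3540805887, -81096346959158⟩ : WeierstrassCurve ℚ).selmerGroup (2 ^ 2)) = 2 ^ 4)
    (hs₂ : Nat.card ((⟨0, 0, 0, -3540805887, -81096346959158⟩ : WeierstrassCurve ℚ).selmerGroup (2 ^ (2 + 1))) = 2 ^ 6)
    {q : ℚ} (hq : haveI := isElliptic_261648q1; shaAn (⟨0, 0, 0, -3540805887, -81096346959158⟩ : WeierstrassCurve ℚ) = (q : ℂ)) (hv : padicValRat 2 q ≤ 6) :
    BSDp W 2 := by
  exact bsdp_two_of_isIsogenous_261648q1_of_conjA hSharp hGZK hmod hCT hCassels (conjA_two_261648q1_of_narrowRankEq₁₂_kernelLit hθ hnr) hiso hr hs₁ hs₂ hq hv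

/-! ## Row `279440c1` (Δ_cubic > 0; stamp `AddKatoTwo.conjA_two_279440c1_of_narrowRankEq₁₂` of §1) -/

/-- **(A) at `(279440c1, 2)` for the Cremona model from ONE displayed narrow-rank equality at layers `1 / 2`, NO print fact**: §1's stamp transported
from its cast model to the literal model. [cite: CoatesSujatha2005, statement (A)] -/
theorem conjA_two_279440c1_of_narrowRankEq₁₂_kernelLit
    {θ : AlgebraicClosure ℚ} (hθ : aeval θ (Cubic.toPoly ⟨1, ((-1 : ℤ) : ℚ), ((-36 : ℤ) : ℚ), ((-70 : ℤ) : ℚ)⟩) = 0)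
    (hnr : haveI : FiniteDimensional ℚ (IntermediateField.adjoin ℚ {θ}) :=
        IntermediateField.adjoin.finiteDimensional ((AlgebraicClosure.isAlgebraic ℚ).isAlgebraic θ).isIntegral
      haveI : NumberField (IntermediateField.adjoin ℚ {θ}) := NumberField.mk
      ∀ κL : ZpExtension (IntermediateField.adjoin ℚ {θ}) 2, κL.IsCyclotomic →
        ∀ [NumberField ↥(κL.layer 1)] [NumberField ↥(κL.layer 2)],
          (powMonoidHom (α := NarrowClassGroup ↥(κL.layer 2)) 2).range.index =
            (powMonoidHom (α := NarrowClassGroup ↥(κL.layer 1)) 2).range.index)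
    :
    haveI := isElliptic_279440c1
    ∀ (κ : ZpExtension ℚ 2), κ.IsCyclotomic →
      ∃ (γ : Field.absoluteGaloisGroup ℚ) (D : (⟨0, 1, 0, -114041197436, -14823196533966296⟩ : WeierstrassCurve ℚ).FineSelmerDualData κ γ),
        Module.Finite ℤ_[2] (RestrictScalars ℤ_[2] (IwasawaAlgebra 2) D.X) :=
  conjA_two_of_eq'' (W' := (⟨0, ((1 : ℤ) : ℚ), 0, ((-114041197436 : ℤ) : ℚ), ((-14823196533966296 : ℤ) : ℚ)⟩ : WeierstrassCurve ℚ)) (by norm_num) (fun κ hκ ↦ AddKatoTwo.conjA_two_279440c1_of_narrowRankEq₁₂ hθ hnr κ hκ)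

/-- **`BSD₂(279440c1)` with (A) from ONE displayed narrow-rank equality at layers `1 / 2` and NO print fact for (A)**: GEN 3's rung `bsdp_two_279440c1_of_conjA` with `hA`
from `conjA_two_279440c1_of_narrowRankEq₁₂_kernelLit hθ hnr`. Conditional on PRINT {`hSharp` (reading), `hGZK`, `hmod`, `hCT`}, the RECORD `hr`, `#Ш_an = q`
(bounded `ord₂ q`), the two VALUED slots and the (unvalued) instrument equality `hnr` — the rung `n = 1` companion of GEN 11's `…narrowRankEq` rung (layers `0 / 1`).
Nothing booked; BSD is not proved by this. [cite: Kato2004Asterisque, Thm. 12.5 (1)(3), 13.8, 14.14] [cite: Fukuda1994, Thm. 1 (2)] [cite: Miller2011LMS, Def. 1.1] -/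
theorem bsdp_two_279440c1_narrowRankEq₁₂
    (hSharp : Kato2004.rankZero_padicValNat_sha_add_padicValNat_tamagawa_le_at_two_of_irreducible_of_fineSelmerDual_fg)
    (hGZK : rank_eq_analyticRank_of_analyticRank_le_one) (hmod : hasEntireLFunction_rat)
    (hCT : exists_casselsTate_pairing (K := ℚ))
    {θ : AlgebraicClosure ℚ} (hθ : aeval θ (Cubic.toPoly ⟨1, ((-1 : ℤ) : ℚ), ((-36 : ℤ) : ℚ), ((-70 : ℤ) : ℚ)⟩) = 0)
    (hnr : haveI : FiniteDimensional ℚ (IntermediateField.adjoin ℚ {θ}) :=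
        IntermediateField.adjoin.finiteDimensional ((AlgebraicClosure.isAlgebraic ℚ).isAlgebraic θ).isIntegral
      haveI : NumberField (IntermediateField.adjoin ℚ {θ}) := NumberField.mk
      ∀ κL : ZpExtension (IntermediateField.adjoin ℚ {θ}) 2, κL.IsCyclotomic →
        ∀ [NumberField ↥(κL.layer 1)] [NumberField ↥(κL.layer 2)],
          (powMonoidHom (α := NarrowClassGroup ↥(κL.layer 2)) 2).range.index =
            (powMonoidHom (α := NarrowClassGroup ↥(κL.layer 1)) 2).range.index)
    (hr : haveI := isElliptic_279440c1; (⟨0, 1, 0, -114041197436, -14823196533966296⟩ : WeierstrassCurve ℚ).analyticRank = 0)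
    (hs₁ : Nat.card ((⟨0, 1, 0, -114041197436, -14823196533966296⟩ : WeierstrassCurve ℚ).selmerGroup (2 ^ 2)) = 2 ^ 4)
    (hs₂ : Nat.card ((⟨0, 1, 0, -114041197436, -14823196533966296⟩ : WeierstrassCurve ℚ).selmerGroup (2 ^ (2 + 1))) = 2 ^ 6)
    {q : ℚ} (hq : haveI := isElliptic_279440c1; shaAn (⟨0, 1, 0, -114041197436, -14823196533966296⟩ : WeierstrassCurve ℚ) = (q : ℂ)) (hv : padicValRat 2 q ≤ 6) :
    haveI := isElliptic_279440c1; haveI := isGloballyMinimal_279440c1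
    BSDp (⟨0, 1, 0, -114041197436, -14823196533966296⟩ : WeierstrassCurve ℚ) 2 := by
  exact bsdp_two_279440c1_of_conjA hSharp hGZK hmod hCT (conjA_two_279440c1_of_narrowRankEq₁₂_kernelLit hθ hnr) hr hs₁ hs₂ hq hv

/-- **`BSD₂` ON THE WHOLE CLASS of `279440c1` with (A) from ONE displayed narrow-rank equality at layers `1 / 2` and NO print fact for (A)**: GEN 3's class rung
(Cassels transport `hCassels`) with `hA` from `conjA_two_279440c1_of_narrowRankEq₁₂_kernelLit hθ hnr`. Nothing booked; BSD is not proved by this.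
[cite: Cassels1965ArithmeticVIII, Thm. 1.3] [cite: Kato2004Asterisque, Thm. 12.5 (1)(3)] [cite: Fukuda1994, Thm. 1 (2)] -/
theorem bsdp_two_of_isIsogenous_279440c1_narrowRankEq₁₂
    (hSharp : Kato2004.rankZero_padicValNat_sha_add_padicValNat_tamagawa_le_at_two_of_irreducible_of_fineSelmerDual_fg)
    (hGZK : rank_eq_analyticRank_of_analyticRank_le_one) (hmod : hasEntireLFunction_rat)
    (hCT : exists_casselsTate_pairing (K := ℚ)) (hCassels : bsdRHS_eq_of_isIsogenous)
    {θ : AlgebraicClosure ℚ} (hθ : aeval θ (Cubic.toPoly ⟨1, ((-1 : ℤ) : ℚ), ((-36 : ℤ) : ℚ), ((-70 : ℤ) : ℚ)⟩) = 0)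
    (hnr : haveI : FiniteDimensional ℚ (IntermediateField.adjoin ℚ {θ}) :=
        IntermediateField.adjoin.finiteDimensional ((AlgebraicClosure.isAlgebraic ℚ).isAlgebraic θ).isIntegral
      haveI : NumberField (IntermediateField.adjoin ℚ {θ}) := NumberField.mk
      ∀ κL : ZpExtension (IntermediateField.adjoin ℚ {θ}) 2, κL.IsCyclotomic →
        ∀ [NumberField ↥(κL.layer 1)] [NumberField ↥(κL.layer 2)],
          (powMonoidHom (α := NarrowClassGroup ↥(κL.layer 2)) 2).range.index =
            (powMonoidHom (α := NarrowClassGroup ↥(κL.layer 1)) 2).range.index)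
    {W : WeierstrassCurve ℚ} [W.IsElliptic] [W.IsGloballyMinimal]
    (hiso : haveI := isElliptic_279440c1; IsIsogenous W (⟨0, 1, 0, -114041197436, -14823196533966296⟩ : WeierstrassCurve ℚ)) (hr : W.analyticRank = 0)
    (hs₁ : Nat.card ((⟨0, 1, 0, -114041197436, -14823196533966296⟩ : WeierstrassCurve ℚ).selmerGroup (2 ^ 2)) = 2 ^ 4)
    (hs₂ : Nat.card ((⟨0, 1, 0, -114041197436, -14823196533966296⟩ : WeierstrassCurve ℚ).selmerGroup (2 ^ (2 + 1))) = 2 ^ 6)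
    {q : ℚ} (hq : haveI := isElliptic_279440c1; shaAn (⟨0, 1, 0, -114041197436, -14823196533966296⟩ : WeierstrassCurve ℚ) = (q : ℂ)) (hv : padicValRat 2 q ≤ 6) :
    BSDp W 2 := by
  exact bsdp_two_of_isIsogenous_279440c1_of_conjA hSharp hGZK hmod hCT hCassels (conjA_two_279440c1_of_narrowRankEq₁₂_kernelLit hθ hnr) hiso hr hs₁ hs₂ hq hv

/-! ## Row `293200be1` (Δ_cubic > 0; stamp `AddKatoTwo.conjA_two_293200be1_of_narrowRankEq₁₂` of §1) -/

/-- **(A) at `(293200be1, 2)` for the Cremona model from ONE displayed narrow-rank equality at layers `1 / 2`, NO print fact**: §1's stamp transported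
from its cast model to the literal model. [cite: CoatesSujatha2005, statement (A)] -/
theorem conjA_two_293200be1_of_narrowRankEq₁₂_kernelLit
    {θ : AlgebraicClosure ℚ} (hθ : aeval θ (Cubic.toPoly ⟨1, ((-1 : ℤ) : ℚ), ((-7 : ℤ) : ℚ), ((8 : ℤ) : ℚ)⟩) = 0)
    (hnr : haveI : FiniteDimensional ℚ (IntermediateField.adjoin ℚ {θ}) :=
        IntermediateField.adjoin.finiteDimensional ((AlgebraicClosure.isAlgebraic ℚ).isAlgebraic θ).isIntegral
      haveI : NumberField (IntermediateField.adjoin ℚ {θ}) := NumberField.mk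
      ∀ κL : ZpExtension (IntermediateField.adjoin ℚ {θ}) 2, κL.IsCyclotomic →
        ∀ [NumberField ↥(κL.layer 1)] [NumberField ↥(κL.layer 2)],
          (powMonoidHom (α := NarrowClassGroup ↥(κL.layer 2)) 2).range.index =
            (powMonoidHom (α := NarrowClassGroup ↥(κL.layer 1)) 2).range.index)
    :
    haveI := isElliptic_293200be1
    ∀ (κ : ZpExtension ℚ 2), κ.IsCyclotomic →
      ∃ (γ : Field.absoluteGaloisGroup ℚ) (D : (⟨0, 1, 0, -3388217033, -75912170159062⟩ : WeierstrassCurve ℚ).FineSelmerDualData κ γ),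
        Module.Finite ℤ_[2] (RestrictScalars ℤ_[2] (IwasawaAlgebra 2) D.X) :=
  conjA_two_of_eq'' (W' := (⟨0, ((1 : ℤ) : ℚ), 0, ((-3388217033 : ℤ) : ℚ), ((-75912170159062 : ℤ) : ℚ)⟩ : WeierstrassCurve ℚ)) (by norm_num) (fun κ hκ ↦ AddKatoTwo.conjA_two_293200be1_of_narrowRankEq₁₂ hθ hnr κ hκ)

/-- **`BSD₂(293200be1)` with (A) from ONE displayed narrow-rank equality at layers `1 / 2` and NO print fact for (A)**: GEN 3's rung `bsdp_two_293200be1_of_conjA` with `hA`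
from `conjA_two_293200be1_of_narrowRankEq₁₂_kernelLit hθ hnr`. Conditional on PRINT {`hSharp` (reading), `hGZK`, `hmod`, `hCT`}, the RECORD `hr`, `#Ш_an = q`
(bounded `ord₂ q`), the two VALUED slots and the (unvalued) instrument equality `hnr` — the rung `n = 1` companion of GEN 11's `…narrowRankEq` rung (layers `0 / 1`).
Nothing booked; BSD is not proved by this. [cite: Kato2004Asterisque, Thm. 12.5 (1)(3), 13.8, 14.14] [cite: Fukuda1994, Thm. 1 (2)] [cite: Miller2011LMS, Def. 1.1] -/
theorem bsdp_two_293200be1_narrowRankEq₁₂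
    (hSharp : Kato2004.rankZero_padicValNat_sha_add_padicValNat_tamagawa_le_at_two_of_irreducible_of_fineSelmerDual_fg)
    (hGZK : rank_eq_analyticRank_of_analyticRank_le_one) (hmod : hasEntireLFunction_rat)
    (hCT : exists_casselsTate_pairing (K := ℚ))
    {θ : AlgebraicClosure ℚ} (hθ : aeval θ (Cubic.toPoly ⟨1, ((-1 : ℤ) : ℚ), ((-7 : ℤ) : ℚ), ((8 : ℤ) : ℚ)⟩) = 0)
    (hnr : haveI : FiniteDimensional ℚ (IntermediateField.adjoin ℚ {θ}) :=
        IntermediateField.adjoin.finiteDimensional ((AlgebraicClosure.isAlgebraic ℚ).isAlgebraic θ).isIntegral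
      haveI : NumberField (IntermediateField.adjoin ℚ {θ}) := NumberField.mk
      ∀ κL : ZpExtension (IntermediateField.adjoin ℚ {θ}) 2, κL.IsCyclotomic →
        ∀ [NumberField ↥(κL.layer 1)] [NumberField ↥(κL.layer 2)],
          (powMonoidHom (α := NarrowClassGroup ↥(κL.layer 2)) 2).range.index =
            (powMonoidHom (α := NarrowClassGroup ↥(κL.layer 1)) 2).range.index)
    (hr : haveI := isElliptic_293200be1; (⟨0, 1, 0, -3388217033, -75912170159062⟩ : WeierstrassCurve ℚ).analyticRank = 0)
    (hs₁ : Nat.card ((⟨0, 1, 0, -3388217033, -75912170159062⟩ : WeierstrassCurve ℚ).selmerGroup (2 ^ 2)) = 2 ^ 4)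
    (hs₂ : Nat.card ((⟨0, 1, 0, -3388217033, -75912170159062⟩ : WeierstrassCurve ℚ).selmerGroup (2 ^ (2 + 1))) = 2 ^ 6)
    {q : ℚ} (hq : haveI := isElliptic_293200be1; shaAn (⟨0, 1, 0, -3388217033, -75912170159062⟩ : WeierstrassCurve ℚ) = (q : ℂ)) (hv : padicValRat 2 q ≤ 6) :
    haveI := isElliptic_293200be1; haveI := isGloballyMinimal_293200be1
    BSDp (⟨0, 1, 0, -3388217033, -75912170159062⟩ : WeierstrassCurve ℚ) 2 := by
  exact bsdp_two_293200be1_of_conjA hSharp hGZK hmod hCT (conjA_two_293200be1_of_narrowRankEq₁₂_kernelLit hθ hnr) hr hs₁ hs₂ hq hv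

/-- **`BSD₂` ON THE WHOLE CLASS of `293200be1` with (A) from ONE displayed narrow-rank equality at layers `1 / 2` and NO print fact for (A)**: GEN 3's class rung
(Cassels transport `hCassels`) with `hA` from `conjA_two_293200be1_of_narrowRankEq₁₂_kernelLit hθ hnr`. Nothing booked; BSD is not proved by this.
[cite: Cassels1965ArithmeticVIII, Thm. 1.3] [cite: Kato2004Asterisque, Thm. 12.5 (1)(3)] [cite: Fukuda1994, Thm. 1 (2)] -/
theorem bsdp_two_of_isIsogenous_293200be1_narrowRankEq₁₂
    (hSharp : Kato2004.rankZero_padicValNat_sha_add_padicValNat_tamagawa_le_at_two_of_irreducible_of_fineSelmerDual_fg)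
    (hGZK : rank_eq_analyticRank_of_analyticRank_le_one) (hmod : hasEntireLFunction_rat)
    (hCT : exists_casselsTate_pairing (K := ℚ)) (hCassels : bsdRHS_eq_of_isIsogenous)
    {θ : AlgebraicClosure ℚ} (hθ : aeval θ (Cubic.toPoly ⟨1, ((-1 : ℤ) : ℚ), ((-7 : ℤ) : ℚ), ((8 : ℤ) : ℚ)⟩) = 0)
    (hnr : haveI : FiniteDimensional ℚ (IntermediateField.adjoin ℚ {θ}) :=
        IntermediateField.adjoin.finiteDimensional ((AlgebraicClosure.isAlgebraic ℚ).isAlgebraic θ).isIntegral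
      haveI : NumberField (IntermediateField.adjoin ℚ {θ}) := NumberField.mk
      ∀ κL : ZpExtension (IntermediateField.adjoin ℚ {θ}) 2, κL.IsCyclotomic →
        ∀ [NumberField ↥(κL.layer 1)] [NumberField ↥(κL.layer 2)],
          (powMonoidHom (α := NarrowClassGroup ↥(κL.layer 2)) 2).range.index =
            (powMonoidHom (α := NarrowClassGroup ↥(κL.layer 1)) 2).range.index)
    {W : WeierstrassCurve ℚ} [W.IsElliptic] [W.IsGloballyMinimal]
    (hiso : haveI := isElliptic_293200be1; IsIsogenous W (⟨0, 1, 0, -3388217033, -75912170159062⟩ : WeierstrassCurve ℚ)) (hr : W.analyticRank = 0)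
    (hs₁ : Nat.card ((⟨0, 1, 0, -3388217033, -75912170159062⟩ : WeierstrassCurve ℚ).selmerGroup (2 ^ 2)) = 2 ^ 4)
    (hs₂ : Nat.card ((⟨0, 1, 0, -3388217033, -75912170159062⟩ : WeierstrassCurve ℚ).selmerGroup (2 ^ (2 + 1))) = 2 ^ 6)
    {q : ℚ} (hq : haveI := isElliptic_293200be1; shaAn (⟨0, 1, 0, -3388217033, -75912170159062⟩ : WeierstrassCurve ℚ) = (q : ℂ)) (hv : padicValRat 2 q ≤ 6) :
    BSDp W 2 := by
  exact bsdp_two_of_isIsogenous_293200be1_of_conjA hSharp hGZK hmod hCT hCassels (conjA_two_293200be1_of_narrowRankEq₁₂_kernelLit hθ hnr) hiso hr hs₁ hs₂ hq hv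

end Summit.BirchSwinnertonDyer.BirchSwinnertonDyer.Theorems.AddPotGoodInstances

end
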